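import Literature.NumberTheory.IwasawaTheory.Greenberg2006.CoinducedModuleDual
import Mathlib.RingTheory.Ideal.Height
import HarnessLib

/-!
# Route `EisensteinPrimes` (rung K5), crux 2 `GoodLatticeBDPValue`, line `halves` v5, stub
# `stub_noPseudoNull`, road (γ): pseudo-nullity under a ring automorphism, and the CONSUMER SHAPE
# of the Shapiro bridge K-Sh (helper for stmt-BirchSwinnertonDyer-19032)

Cell `bsd-eis`, seat `bsd-eis-k5-c2` (gen 9). Generic commutative algebra for the last step of road
(γ) (HOME/k5-c2-MEMO-8.md §3 (K-Sh), "NOTE THE INVOLUTION"): Greenberg's twist deformation is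
`ρ₀ ⊗ κ⁻¹`, so the `Λ₂ = ℤ_p⟦T₁,T₂⟧`-structure that Prop. 4.1.1 (c) puts on `S_{𝓛_𝔭}(K, 𝐃)` matches
the one of a `Rubin1991.DualData₂` (`Tᵢ ↦ conj_{γᵢ} − 1`) only up to the ring automorphism
`ι : γ ↦ γ⁻¹` of `Λ₂`. Pseudo-nullity does not see `ι`:

* §1 `Module.IsPseudoNull` is transported along any additive isomorphism that is SEMILINEAR over a
  ring automorphism `ι : R ≃+* R` (`f (r • m) = ι r • f m`): `ι` permutes the primes of height `≤ 1`
  (`RingEquiv.height_comap`) and `M_𝔭 = 0 ⇔ N_{ι𝔭} = 0`.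
* §2 THE CONSUMER SHAPE OF K-Sh: if a discrete `Λ`-module `S` is almost divisible
  (`Greenberg2016.IsAlmostDivisible`: every balanced Pontryagin dual has no non-zero pseudo-null
  submodule) and `X` is ANY abelian group with a `Λ`-structure, identified with `Hom(S', ℚ/ℤ)` for
  some `S' ≃ S` (additively) so that the pairing is balanced UP TO `ι`
  (`toDual (r • x) (e s) = toDual x (e (ι r • s))`), then `X` has no non-zero pseudo-null
  `Λ`-submodule. With `S = S_{𝓛_𝔭}(K, 𝐃_θ)` (the instance theorem
  `GreenbergFullAtSelmer.twistDeformation_fullAtSelmer_isAlmostDivisible_of_linearEquiv`),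
  `S' = H¹_{nr}(K̃_∞, A_θ)` (`Rubin1991.unrSelmer₂`), `X = D.X` for a `Rubin1991.DualData₂` and `e`
  the Shapiro identification, this is exactly `stub_noPseudoNull`'s conclusion; the bridge `e`
  with its `ι`-semilinearity is what remains (K-Sh; NOT here).

Theorems only (Mathlib's `CharacterModule S` is the canonical balanced dual,
`Greenberg2016.isDualPairing_characterModule`); no named fact, no `sorry`. HONEST FRAMING: generic
algebra; closes nothing by itself (`--supports`).
References: Bourbaki, *Algèbre commutative* VII §4.4 (pseudo-null modules); [Greenberg2016Selmer]
§1 p. 2 (almost divisible ⇔ dual has no non-zero pseudo-null submodule); [Greenberg2006] p. 342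
L5 (`ρ = ρ₀ ⊗ κ⁻¹`); [KellerYin2024] Thm. 2.2.1 (the involution `ι`).
-/

set_option autoImplicit false
set_option linter.dupNamespace false

noncomputable section

open Literature.NumberTheory.EllipticCurves Literature.NumberTheory.IwasawaTheory
  Literature.NumberTheory.IwasawaTheory.Greenberg2016

universe u

namespace Summit.BirchSwinnertonDyer.BirchSwinnertonDyer.Theorems.GreenbergFullAtSelmer

/-! ## §1. Pseudo-nullity along a semilinear isomorphism -/

section Transport

variable {R : Type*} [CommRing R] {M N : Type*} [AddCommGroup M] [Module R M] [AddCommGroup N]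
  [Module R N]

/-- **Pseudo-nullity is invariant under twisting by a ring automorphism**: if `f : M ≃ N` is additive
and `ι`-semilinear (`f (r • m) = ι r • f m`) for a ring automorphism `ι` of `R`, and `M` is
pseudo-null, then so is `N` — `ι` carries the primes of height `≤ 1` onto themselves and
`M_𝔭 = 0` gives `N_{ι(𝔭)} = 0`. (Bourbaki AC VII §4.4; the "`ι`-invariance of pseudo-nullity" of
the cell's K-Sh note.) [folklore] -/
theorem isPseudoNull_of_addEquiv_semilinear (ι : R ≃+* R) (f : M ≃+ N)
    (hf : ∀ (r : R) (m : M), f (r • m) = ι r • f m) (hM : Module.IsPseudoNull R M) :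
    Module.IsPseudoNull R N := by
  intro 𝔮 h𝔮
  rw [LocalizedModule.subsingleton_iff]
  intro n
  let 𝔭 : PrimeSpectrum R := ⟨𝔮.asIdeal.comap ι, Ideal.comap_isPrime ι _⟩
  have h𝔭 : 𝔭.asIdeal.height ≤ 1 := by
    change (𝔮.asIdeal.comap ι).height ≤ 1
    rw [RingEquiv.height_comap]
    exact h𝔮
  have h := hM 𝔭 h𝔭
  rw [LocalizedModule.subsingleton_iff] at h
  obtain ⟨r, hr, hrm⟩ := h (f.symm n)
  refine ⟨ι r, ?_, ?_⟩
  · intro (h' : ι r ∈ 𝔮.asIdeal)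
    exact hr (show r ∈ 𝔭.asIdeal from h')
  · rw [← f.apply_symm_apply n, ← hf, hrm, map_zero]

/-- The symmetric form: pseudo-nullity transfers both ways along an `ι`-semilinear additive
isomorphism. [folklore] -/
theorem isPseudoNull_iff_of_addEquiv_semilinear (ι : R ≃+* R) (f : M ≃+ N)
    (hf : ∀ (r : R) (m : M), f (r • m) = ι r • f m) :
    Module.IsPseudoNull R M ↔ Module.IsPseudoNull R N := by
  refine ⟨isPseudoNull_of_addEquiv_semilinear ι f hf, fun hN ↦ ?_⟩
  refine isPseudoNull_of_addEquiv_semilinear ι.symm f.symm (fun r n ↦ ?_) hN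
  apply f.injective
  rw [f.apply_symm_apply, hf, RingEquiv.apply_symm_apply, f.apply_symm_apply]

end Transport

/-! ## §2. No pseudo-null submodule in ANY `ι`-balanced dual of an almost divisible module -/

section Consumer

variable {Λ : Type u} [CommRing Λ] {S : Type u} [AddCommGroup S] [Module Λ S]
  {S' : Type u} [AddCommGroup S'] {X : Type u} [AddCommGroup X] [Module Λ X]

/-- The comparison map `x ↦ toDual x ∘ e : X → Hom(S, ℚ/ℤ)` of an `ι`-balanced dual into Mathlib's
`CharacterModule S`. [folklore] -/
theorem exists_characterModule_hom_semilinear (ι : Λ ≃+* Λ) (e : S ≃+ S')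
    (toDual : X →+ (S' →+ AddCircle (1 : ℚ))) (hbij : Function.Bijective toDual)
    (hsemi : ∀ (r : Λ) (x : X) (s : S), toDual (r • x) (e s) = toDual x (e (ι r • s))) :
    ∃ Φ : X →+ CharacterModule S, Function.Injective Φ ∧
      (∀ x s, Φ x s = toDual x (e s)) ∧ ∀ (r : Λ) (x : X), Φ (r • x) = ι r • Φ x := by
  let Φ : X →+ CharacterModule S :=
    { toFun := fun x ↦ (toDual x).comp e.toAddMonoidHom
      map_zero' := by rw [map_zero, AddMonoidHom.zero_comp]; rfl
      map_add' := fun x y ↦ by rw [map_add, AddMonoidHom.add_comp]; rfl }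
  refine ⟨Φ, fun x y hxy ↦ hbij.1 ?_, fun _ _ ↦ rfl, fun r x ↦ ?_⟩
  · ext s'
    have := congrArg (fun φ : CharacterModule S ↦ φ (e.symm s')) hxy
    change toDual x (e (e.symm s')) = toDual y (e (e.symm s')) at this
    rwa [e.apply_symm_apply] at this
  · ext s
    change toDual (r • x) (e s) = toDual x (e (ι r • s))
    exact hsemi r x s

/-- **THE CONSUMER SHAPE OF K-Sh — an `ι`-balanced Pontryagin dual of an almost divisible
`Λ`-module has no non-zero pseudo-null submodule.** If `S` is almost divisible over `Λ`
(`Greenberg2016.IsAlmostDivisible`), `e : S ≃ S'` is additive, and `toDual : X ≅ Hom(S', ℚ/ℤ)`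
identifies the `Λ`-module `X` with the characters of `S'` so that
`toDual (r • x) (e s) = toDual x (e (ι r • s))` for a ring automorphism `ι` of `Λ`, then every
pseudo-null `Λ`-submodule of `X` is `0`: the image of such a submodule in `CharacterModule S` (a
balanced dual, where almost divisibility applies) is a `Λ`-submodule, pseudo-null by §1. For Rubin's
`DualData₂` (`X = D.X`, `S' = H¹_{nr}(K̃_∞, A_θ)`), Greenberg's `S = S_{𝓛_𝔭}(K, 𝐃_θ)` and the Shapiro
identification `e` this is the conclusion of `stub_noPseudoNull`.
[cite: Greenberg2016Selmer, §1 p. 2 L17–35] -/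
theorem hasNoPseudoNullSubmodule_of_isAlmostDivisible_of_semilinear
    (h : Greenberg2016.IsAlmostDivisible Λ S) (ι : Λ ≃+* Λ) (e : S ≃+ S')
    (toDual : X →+ (S' →+ AddCircle (1 : ℚ))) (hbij : Function.Bijective toDual)
    (hsemi : ∀ (r : Λ) (x : X) (s : S), toDual (r • x) (e s) = toDual x (e (ι r • s))) :
    HasNoPseudoNullSubmodule Λ X := by
  intro N hN
  obtain ⟨Φ, hΦinj, -, hΦsmul⟩ := exists_characterModule_hom_semilinear ι e toDual hbij hsemi
  -- the image of `N` is a `Λ`-submodule of the canonical dual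
  let N₀ : Submodule Λ (CharacterModule S) :=
    { carrier := Φ '' (N : Set X)
      zero_mem' := ⟨0, N.zero_mem, map_zero Φ⟩
      add_mem' := by
        rintro _ _ ⟨x, hx, rfl⟩ ⟨y, hy, rfl⟩
        exact ⟨x + y, N.add_mem hx hy, map_add Φ x y⟩
      smul_mem' := by
        rintro r _ ⟨x, hx, rfl⟩
        refine ⟨ι.symm r • x, N.smul_mem _ hx, ?_⟩
        rw [hΦsmul, RingEquiv.apply_symm_apply] }
  -- `N ≃ N₀`, `ι`-semilinear
  let f : N → N₀ := fun x ↦ ⟨Φ (x : X), (x : X), x.2, rfl⟩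
  have hfbij : Function.Bijective f := by
    refine ⟨fun x y hxy ↦ Subtype.ext (hΦinj (congrArg Subtype.val hxy)), ?_⟩
    rintro ⟨_, x, hx, rfl⟩
    exact ⟨⟨x, hx⟩, rfl⟩
  let fe : N ≃+ N₀ :=
    AddEquiv.ofBijective
      ({ toFun := f
         map_zero' := Subtype.ext (map_zero Φ)
         map_add' := fun x y ↦ Subtype.ext (map_add Φ (x : X) (y : X)) } : N →+ N₀) hfbij
  have hfe : ∀ (r : Λ) (m : N), fe (r • m) = ι r • fe m :=
    fun r m ↦ Subtype.ext (hΦsmul r (m : X))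
  have hN₀ : Module.IsPseudoNull Λ N₀ := isPseudoNull_of_addEquiv_semilinear ι fe hfe hN
  have h0 : N₀ = ⊥ := h (CharacterModule S) (AddMonoidHom.id _)
    (isDualPairing_characterModule Λ S) N₀ hN₀
  refine (Submodule.eq_bot_iff N).mpr fun x hx ↦ hΦinj ?_
  rw [map_zero]
  have hx0 : Φ x ∈ N₀ := ⟨x, hx, rfl⟩
  rw [h0] at hx0
  exact (Submodule.mem_bot Λ).mp hx0

end Consumer

end Summit.BirchSwinnertonDyer.BirchSwinnertonDyer.Theorems.GreenbergFullAtSelmer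

end
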